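import Literature.MathematicalPhysics.PowerSystems.ClassicalSwingLossyStabilityPersistence
import HarnessLib

/-!
# The classical swing model with small transfer conductances, II: a UNIFORM exponential rate over
# the whole perturbation class (Khalil Lemma 9.1 / Theorem 4.10 made explicit for ★ #321's
# persistence theorem)

Topic `Literature/MathematicalPhysics/PowerSystems` (LADDER rungs G2 / G3.b); namespace
`…PowerSystems.InternalNode`.  Sequel of `ClassicalSwingLossyStabilityPersistence.lean` (★ #321:
`exists_lyapunovCertificate_of_cohesive` — the Lyapunov-matrix certificate `(P, q₀)` at a cohesive
lossless operating point; `lossy_expStable_modRotation_of_jacobian_close` /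
`…_of_small_conductances` — exponential stability modulo rotation persists, with a rate `λ > 0`
EXISTENTIAL PER LOSSY MODEL), BY NAME over `ClassicalSwingLossyExponentialStability.lean` §3 (★ #265's
RATE theorem `syncEquilibrium_expStable_lossy_rate_of_lyapunovCertificate`: from a certificate
`(P, p₁, q₀)` every `α' < q₀/p₁` is an exponential rate) and `DroopMicrogridLossyStabilityPersistence`
§1 (`lyapunovIneq_of_entries_close`, lit-2 g14: the certificate survives an entrywise `δ`-perturbation
of the Jacobian with margin `q₀/2`).  This file makes the rate UNIFORM: one `ᾱ > 0`, computed from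
the lossless certificate alone, works for every lossy model in the perturbation class — the
quantitative content of «the exponential stability property … is robust» (lit-2 g14 typed the droop
analogue, `DroopPH.exists_syncMotion_expStable_uniformRate_of_small_conductance`).  Everything below is
PROVED: 0 definitions, 0 named facts, 0 `sorry`, no new axiom.

SOURCES (read on the page).  [SimpsonporcoDorflerBullo2013] arXiv:1206.5033 §3 remark after
Theorem 2 (held text p0010 L22): «since the eigenvalues of a matrix are continuous functions of its
entries, the exponential stability property established in Theorem 2 is robust, and the stable
synchronous solution persists in the presence of sufficiently small line conductances [HDC-CCC:95]».
[DorflerBullo2012] arXiv:0910.5673 §I (p0008 L36–L40): «can also be extended to "sufficiently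
small" transfer conductances [HDC-CCC:95]».  [Khalil2002] H. K. Khalil, *Nonlinear Systems*, 3rd ed.:
Theorem 4.10 (a quadratic Lyapunov function `λ_min(P)‖x‖² ≤ V ≤ λ_max(P)‖x‖²`, `V̇ ≤ −c₃‖x‖²` gives
the exponential rate `c₃/(2λ_max(P))`), §9.1 Lemma 9.1 (under a perturbation `‖g(x)‖ ≤ γ‖x‖` with
`γ < c₃/c₄` the SAME `V` certifies exponential stability with rate `(c₃ − γc₄)/(2c₂)` — uniform in
the perturbation class), Theorems 4.6–4.7 — all through the two imported tree files, whose
docstrings carry the locators.  [Chiang1995] §6.1 (reference machine) — through ★ #265's file.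

RENDERING.  As in the persistence file: `d : InternalNode m` the LOSSLESS reference data, `δˢ`
cohesive, `i₀` a reference machine; a lossy model is any `d' : InternalNode m` (§2) or `⟨H, D, P'_m, E,
G', B, ω_s⟩` (§3); «exponentially stable modulo rotation with rate `α'`» = the conclusion of ★ #265's
rate theorem verbatim (`∃ ρ k > 0`, every solution starting `ρ`-close has `‖(δ(t) − δˢ' − c𝟙, ω(t) −
ω_s𝟙)‖ ≤ k‖(δ(0) − δˢ', ω(0) − ω_s𝟙)‖e^{−α't}` on every `[0, T]`).

WHAT IS PROVED (0 `def`, 0 named facts, 0 `sorry`):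
* §1 private tools: `uᵀPu ≤ (Σ|P_ij|)uᵀu`; the entrywise Jacobian bound `|J'(δˢ') − J(δˢ)| ≤
  2εW·ΣM_i⁻¹` (`W = Σ_{i,k}|E_iE_k|(2|B_ik| + 1)`) for `|G'| ≤ ε`, `|δˢ' − δˢ| ≤ ε` — re-proved here
  verbatim from the persistence file, where they are private.
* §2 ★★★ **`lossy_expStable_modRotation_rate_of_jacobian_close`**: `∃ δ₀ > 0, ∃ ᾱ > 0` such that
  EVERY `d'` and equilibrium `δˢ'` with `|J'(δˢ')_kl − J(δˢ)_kl| ≤ δ₀` is exponentially stable modulo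
  rotation with EVERY rate `α' ∈ (0, ᾱ)`; `ᾱ = (q₀/2)/(Σ|P_ij| + 1)`.
* §3 ★★★ **`lossy_expStable_modRotation_rate_of_small_conductances`**: `∃ ε > 0, ∃ ᾱ > 0` such that
  for every `G'` with `|G'_ij| ≤ ε`, every `P'_m`, every equilibrium `δˢ'` of `⟨H, D, P'_m, E, G', B,
  ω_s⟩` with `|δˢ'_i − δˢ_i| ≤ ε`, and every `α' ∈ (0, ᾱ)`: exponentially stable modulo rotation
  with rate `α'`.

PROOF ROUTE.  §2: certificate `(P, q₀)` from `exists_lyapunovCertificate_of_cohesive`; `δ₀ =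
q₀/(2(S+1))`, `S = |ι|·Σ|P_ij|`, so `lyapunovIneq_of_entries_close` yields the certificate for `J'`
with margin `q₀/2`; `p₁ = Σ|P_ij| + 1` bounds `uᵀPu ≤ p₁uᵀu`; ★ #265's rate theorem with `(P, p₁,
q₀/2)`.  §3: `ε = δ₀/(2W·ΣM⁻¹ + 1)` makes the §1 Jacobian bound `≤ δ₀`.  No numerics.

THREE COLUMNS.  CERTIFIED (kernel theorems): for exact lossless data and a cohesive `δˢ`, the
existence of `(δ₀, ᾱ)` resp. `(ε, ᾱ)` with the stated uniform-rate property for the whole class of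
lossy internal-node models.  MODELLED: classical network-reduced multimachine swing model with
transfer conductances (constant voltages behind transient reactance, constant-impedance loads folded
into the reduced admittance, `D_i > 0`, uniform `ω_s`), as ★ #265 / ★ #321.  VALIDATED: nothing
numerical.  NOT CLAIMED: explicit numerical values of `ε`, `ᾱ` for any benchmark (they run through
the existential `P, q₀` of Khalil's construction), existence of the nearby lossy equilibrium (IFT),
uniformity of `ρ, k`, large conductances, structure-preserving models.

## References
* [Khalil2002] H. K. Khalil, *Nonlinear Systems*, 3rd ed., Prentice Hall 2002 — Thm 4.6, Thm 4.7,
  Thm 4.10, §9.1 Lemma 9.1.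
* [SimpsonporcoDorflerBullo2013] J. W. Simpson-Porco, F. Dörfler, F. Bullo, Automatica 49 (2013)
  2603–2611, arXiv:1206.5033 — §3, remark after Theorem 2 (p0010 L22).
* [DorflerBullo2012] F. Dörfler, F. Bullo, SIAM J. Control Optim. 50 (2012), arXiv:0910.5673 — §I
  (p0008 L36–L40), [HDC-CCC:95].
* [Chiang1995] H.-D. Chiang, in *Systems and Control Theory for Power Systems* (IMA Vol. 64, 1995),
  §6.1.
-/

noncomputable section

open Set Filter Topology Finset
open scoped Matrix BigOperators

namespace Literature.MathematicalPhysics.PowerSystems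

namespace InternalNode

variable {m : ℕ} {d : InternalNode m}

/-! ### §1. Tools: the sup-norm comparison `uᵀPu ≤ (Σ|P_ij|)uᵀu`, and the entrywise distance of the
lossy Jacobian from the lossless one under small conductances (as in the persistence file) -/

/-- `uᵀPu ≤ (Σ_ij |P_ij|)·uᵀu` for every real matrix (sup-norm comparison). [folklore] -/
private theorem dotProduct_mulVec_le_sumAbs₁₅ {ι : Type*} [Fintype ι] (P : Matrix ι ι ℝ)
    (u : ι → ℝ) : u ⬝ᵥ (P *ᵥ u) ≤ (∑ i, ∑ j, |P i j|) * (u ⬝ᵥ u) := by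
  have hu : ∀ i, |u i| ≤ ‖u‖ := fun i => by simpa using norm_le_pi_norm u i
  have h2 : 0 ≤ u ⬝ᵥ u := Finset.sum_nonneg fun j _ => mul_self_nonneg (u j)
  have hnorm : ‖u‖ ^ 2 ≤ u ⬝ᵥ u := by
    have h1 : ‖u‖ ≤ Real.sqrt (u ⬝ᵥ u) := by
      refine (pi_norm_le_iff_of_nonneg (Real.sqrt_nonneg _)).2 fun i => ?_
      rw [Real.norm_eq_abs, Real.le_sqrt (abs_nonneg _) h2, sq_abs, sq]
      exact Finset.single_le_sum (f := fun j => u j * u j) (fun j _ => mul_self_nonneg (u j))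
        (Finset.mem_univ i)
    exact (Real.le_sqrt (norm_nonneg _) h2).1 h1
  calc u ⬝ᵥ (P *ᵥ u) = ∑ i, ∑ j, u i * P i j * u j := by
        simp only [dotProduct, Matrix.mulVec, Finset.mul_sum]
        exact Finset.sum_congr rfl fun i _ => Finset.sum_congr rfl fun j _ => by ring
    _ ≤ ∑ i, ∑ j, |P i j| * ‖u‖ ^ 2 := by
        refine Finset.sum_le_sum fun i _ => Finset.sum_le_sum fun j _ => ?_
        calc u i * P i j * u j ≤ |u i * P i j * u j| := le_abs_self _
          _ = |P i j| * (|u i| * |u j|) := by rw [abs_mul, abs_mul]; ring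
          _ ≤ |P i j| * (‖u‖ * ‖u‖) :=
              mul_le_mul_of_nonneg_left (mul_le_mul (hu i) (hu j) (abs_nonneg _) (norm_nonneg _))
                (abs_nonneg _)
          _ = |P i j| * ‖u‖ ^ 2 := by ring
    _ = (∑ i, ∑ j, |P i j|) * ‖u‖ ^ 2 := by rw [Finset.sum_mul]; simp [Finset.sum_mul]
    _ ≤ (∑ i, ∑ j, |P i j|) * (u ⬝ᵥ u) :=
        mul_le_mul_of_nonneg_left hnorm
          (Finset.sum_nonneg fun i _ => Finset.sum_nonneg fun j _ => abs_nonneg _)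

/-- The linearised weight moves by at most `ε|E_iE_j|(2|B_ij| + 1)` when `|G'| ≤ ε` and the angles
move by at most `ε` (`cos` is 1-Lipschitz, `|sin| ≤ 1`). [folklore] -/
private theorem lossyWeight_sub_linWeight_le {δs δs' : Fin m → ℝ} {Pm' : Fin m → ℝ}
    {G' : Fin m → Fin m → ℝ} {ε : ℝ} (hG : ∀ i j, |G' i j| ≤ ε) (hδ : ∀ i, |δs' i - δs i| ≤ ε)
    (i j : Fin m) :
    |(⟨d.H, d.D, Pm', d.E, G', d.B, d.ωs⟩ : InternalNode m).lossyWeight δs' i j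
        - d.toDroopNetwork.linWeight δs i j|
      ≤ ε * (|d.E i * d.E j| * (2 * |d.B i j| + 1)) := by
  have hε : 0 ≤ ε := (abs_nonneg _).trans (hδ i)
  have hcos := Real.abs_cos_sub_cos_le (δs' i - δs' j) (δs i - δs j)
  have hsin := Real.abs_sin_le_one (δs' i - δs' j)
  have hang : |δs' i - δs' j - (δs i - δs j)| ≤ 2 * ε := by
    have h := abs_sub (δs' i - δs i) (δs' j - δs j)
    have h' : δs' i - δs' j - (δs i - δs j) = (δs' i - δs i) - (δs' j - δs j) := by ring
    rw [h']; linarith [hδ i, hδ j]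
  have hexp : (⟨d.H, d.D, Pm', d.E, G', d.B, d.ωs⟩ : InternalNode m).lossyWeight δs' i j
        - d.toDroopNetwork.linWeight δs i j
      = d.E i * d.E j * (d.B i j * (Real.cos (δs' i - δs' j) - Real.cos (δs i - δs j)))
        - d.E i * d.E j * (G' i j * Real.sin (δs' i - δs' j)) := by
    simp only [lossyWeight, DroopNetwork.linWeight, toDroopNetwork_a, C]; ring
  rw [hexp]
  refine (abs_sub _ _).trans ?_
  rw [abs_mul (d.E i * d.E j), abs_mul (d.E i * d.E j), abs_mul (d.B i j), abs_mul (G' i j)]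
  have hEE : 0 ≤ |d.E i * d.E j| := abs_nonneg _
  have h1 : |d.B i j| * |Real.cos (δs' i - δs' j) - Real.cos (δs i - δs j)| ≤ |d.B i j| * (2 * ε) :=
    mul_le_mul_of_nonneg_left (hcos.trans hang) (abs_nonneg _)
  have h2 : |G' i j| * |Real.sin (δs' i - δs' j)| ≤ ε * 1 :=
    mul_le_mul (hG i j) hsin (abs_nonneg _) hε
  nlinarith [mul_le_mul_of_nonneg_left h1 hEE, mul_le_mul_of_nonneg_left h2 hEE]

/-- Entrywise distance of the lossy Jacobian at `δˢ'` from the lossless Jacobian at `δˢ`: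
`≤ 2εW·Σ_i M_i⁻¹` with `W = Σ_{i,k} |E_iE_k|(2|B_ik| + 1)`. [folklore] -/
private theorem swingJacG_sub_swingJac_le (hM : ∀ i, 0 < d.M i) {δs δs' : Fin m → ℝ}
    {Pm' : Fin m → ℝ} {G' : Fin m → Fin m → ℝ} {ε : ℝ} (hG : ∀ i j, |G' i j| ≤ ε)
    (hδ : ∀ i, |δs' i - δs i| ≤ ε) (k l : Fin m ⊕ Fin m) :
    |(⟨d.H, d.D, Pm', d.E, G', d.B, d.ωs⟩ : InternalNode m).swingJacG δs' k l - d.swingJac δs k l|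
      ≤ 2 * ε * (∑ i, ∑ j, |d.E i * d.E j| * (2 * |d.B i j| + 1)) * ∑ i, (d.M i)⁻¹ := by
  set d' : InternalNode m := ⟨d.H, d.D, Pm', d.E, G', d.B, d.ωs⟩ with hd'
  set W : ℝ := ∑ i, ∑ j, |d.E i * d.E j| * (2 * |d.B i j| + 1) with hW
  set Δ : Fin m → Fin m → ℝ := fun i j => d'.lossyWeight δs' i j - d.toDroopNetwork.linWeight δs i j
    with hΔ
  have hε : 0 ≤ ε := (abs_nonneg _).trans (hδ (k.elim id id))
  have hterm : ∀ i j, 0 ≤ |d.E i * d.E j| * (2 * |d.B i j| + 1) := fun i j =>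
    mul_nonneg (abs_nonneg _) (by positivity)
  have hW0 : 0 ≤ W := Finset.sum_nonneg fun i _ => Finset.sum_nonneg fun j _ => hterm i j
  have hMinv : 0 ≤ ∑ i, (d.M i)⁻¹ := Finset.sum_nonneg fun i _ => (inv_pos.2 (hM i)).le
  have hΔle : ∀ i j, |Δ i j| ≤ ε * W := fun i j => by
    refine (lossyWeight_sub_linWeight_le (d := d) hG hδ i j).trans (mul_le_mul_of_nonneg_left ?_ hε)
    exact (Finset.single_le_sum (fun j _ => hterm i j) (Finset.mem_univ j)).trans
      (Finset.single_le_sum (fun i _ => Finset.sum_nonneg fun j _ => hterm i j) (Finset.mem_univ i))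
  have hΔsum : ∀ i, |∑ j, Δ i j| ≤ ε * W := fun i => by
    refine (Finset.abs_sum_le_sum_abs _ _).trans ?_
    calc ∑ j, |Δ i j| ≤ ∑ j, ε * (|d.E i * d.E j| * (2 * |d.B i j| + 1)) :=
          Finset.sum_le_sum fun j _ => lossyWeight_sub_linWeight_le (d := d) hG hδ i j
      _ = ε * ∑ j, |d.E i * d.E j| * (2 * |d.B i j| + 1) := by rw [Finset.mul_sum]
      _ ≤ ε * W := mul_le_mul_of_nonneg_left
          (Finset.single_le_sum (fun i _ => Finset.sum_nonneg fun j _ => hterm i j) (Finset.mem_univ i)) hε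
  have hbound : 0 ≤ 2 * ε * W * ∑ i, (d.M i)⁻¹ := by positivity
  have hM' : ∀ i, d'.M i = d.M i := fun i => rfl
  have hD' : ∀ i, d'.D i = d.D i := fun i => rfl
  cases k with
  | inl i =>
    cases l with
    | inl j => simpa [swingJacG, swingJac, Matrix.fromBlocks_apply₁₁] using hbound
    | inr j => simpa [swingJacG, swingJac, Matrix.fromBlocks_apply₁₂] using hbound
  | inr i =>
    cases l with
    | inr j =>
      simpa [swingJacG, swingJac, Matrix.fromBlocks_apply₂₂, Matrix.diagonal_apply, hM', hD'] using hbound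
    | inl j =>
      have hentry : d'.swingJacG δs' (Sum.inr i) (Sum.inl j) - d.swingJac δs (Sum.inr i) (Sum.inl j)
          = -((if i = j then ∑ k, Δ i k else 0) - Δ i j) / d.M i := by
        simp only [swingJacG, swingJac, Matrix.fromBlocks_apply₂₁, DroopNetwork.lap, hΔ, hM',
          Finset.sum_sub_distrib]
        split_ifs <;> ring
      rw [hentry, abs_div, abs_neg, abs_of_pos (hM i)]
      have hnum : |(if i = j then ∑ k, Δ i k else 0) - Δ i j| ≤ 2 * ε * W := by
        refine (abs_sub _ _).trans ?_
        split_ifs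
        · linarith [hΔsum i, hΔle i j]
        · rw [abs_zero]; linarith [hΔle i j, mul_nonneg hε hW0]
      rw [div_le_iff₀ (hM i)]
      have hinv : (d.M i)⁻¹ ≤ ∑ k, (d.M k)⁻¹ :=
        Finset.single_le_sum (fun k _ => (inv_pos.2 (hM k)).le) (Finset.mem_univ i)
      calc |(if i = j then ∑ k, Δ i k else 0) - Δ i j| ≤ 2 * ε * W := hnum
        _ = 2 * ε * W * (d.M i)⁻¹ * d.M i := by rw [mul_assoc (2 * ε * W), inv_mul_cancel₀ (hM i).ne', mul_one]
        _ ≤ 2 * ε * W * (∑ k, (d.M k)⁻¹) * d.M i :=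
          mul_le_mul_of_nonneg_right (mul_le_mul_of_nonneg_left hinv (by positivity)) (hM i).le

/-! ### §2. A UNIFORM exponential rate for every internal-node model whose equilibrium Jacobian is
close to the cohesive lossless one -/

/-- ★★★ **PERSISTENCE WITH A UNIFORM RATE (Khalil Lemma 9.1 / Theorem 4.10: the perturbed rate is
uniform over the perturbation class).**  Classical network-reduced swing model `d` (`M_i, D_i > 0`,
`B` symmetric, couplings `C_ij = E_iE_jB_ij ≥ 0` connected), `δˢ` cohesive (`|δˢ_i − δˢ_j| < π/2`
across every line), reference machine `i₀`.  There are `δ₀ > 0` and a rate `ᾱ > 0` — depending on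
the lossless data and `δˢ` only — such that for EVERY internal-node model `d'` on the same machines
(any transfer conductances, any injections) and every equilibrium `δˢ'` of `d'` whose lossy Jacobian
`J'(δˢ')` is entrywise `δ₀`-close to `J(δˢ)`, and EVERY `0 < α' < ᾱ`: there are `ρ, k > 0` with
`‖(δ(t) − δˢ' − c𝟙, ω(t) − ω_s𝟙)‖ ≤ k‖(δ(0) − δˢ', ω(0) − ω_s𝟙)‖e^{−α't}` on every `[0, T]` (some
rotation `c`) for every solution of `d'` starting `ρ`-close.  (`ᾱ = (q₀/2)/(Σ|P_ij| + 1)` from the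
derived lossless certificate `(P, q₀)`; `ρ, k` may depend on `d'`, the rate does not.)  Companion of
`lossy_expStable_modRotation_of_jacobian_close` (there `λ > 0` was existential per model), by name over
★ #265's rate theorem `syncEquilibrium_expStable_lossy_rate_of_lyapunovCertificate`.
[cite: Khalil2002, §9.1 Lemma 9.1 / Theorem 4.10 (rate of a quadratic Lyapunov function, uniform under small perturbations of the linear part), Theorem 4.6–4.7; SimpsonporcoDorflerBullo2013, §3 remark after Theorem 2 (arXiv:1206.5033 p0010 L22: «the exponential stability property … is robust»); DorflerBullo2012, §I (arXiv:0910.5673 p0008 L36–L40, [HDC-CCC:95])] -/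
theorem lossy_expStable_modRotation_rate_of_jacobian_close (hM : ∀ i, 0 < d.M i)
    (hD : ∀ i, 0 < d.D i) (hB : ∀ i j, d.B i j = d.B j i) (hC : ∀ i j, 0 ≤ d.C i j)
    (hconn : ClassicalModel.CouplingConnected d.C) {δs : Fin m → ℝ}
    (harc : ∀ i j, i ≠ j → 0 < d.C i j → |δs i - δs j| < Real.pi / 2) (i₀ : Fin m) :
    ∃ δ₀ > 0, ∃ αbar > 0, ∀ (d' : InternalNode m) (δs' : Fin m → ℝ), d'.IsEquilibrium δs' →
      (∀ k l, |d'.swingJacG δs' k l - d.swingJac δs k l| ≤ δ₀) →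
      ∀ α' : ℝ, 0 < α' → α' < αbar →
      ∃ ρ > 0, ∃ k > 0, ∀ δ ω : ℝ → Fin m → ℝ, (∀ t, d'.IsSolutionAt δ ω t) →
        ‖phase (δ 0 - δs') (fun i => ω 0 i - d'.ωs)‖ < ρ →
        ∀ T : ℝ, 0 ≤ T → ∃ c : ℝ, ∀ t ∈ Icc 0 T,
          ‖phase (fun i => δ t i - (δs' i + c)) (fun i => ω t i - d'.ωs)‖
            ≤ k * ‖phase (δ 0 - δs') (fun i => ω 0 i - d'.ωs)‖ * Real.exp (-α' * t) := by
  obtain ⟨P, hPs, q₀, hq₀, hpos, hly⟩ := exists_lyapunovCertificate_of_cohesive hM hD hB hC hconn harc i₀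
  set S : ℝ := (Fintype.card (Fin m ⊕ Fin m) : ℝ) * ∑ i, ∑ j, |P i j| with hS_def
  set p₁ : ℝ := (∑ i, ∑ j, |P i j|) + 1 with hp₁
  have hsumP : 0 ≤ ∑ i, ∑ j, |P i j| :=
    Finset.sum_nonneg fun i _ => Finset.sum_nonneg fun j _ => abs_nonneg _
  have hS : 0 ≤ S := mul_nonneg (Nat.cast_nonneg _) hsumP
  have hp₁pos : 0 < p₁ := by rw [hp₁]; linarith
  refine ⟨q₀ / (2 * (S + 1)), by positivity, q₀ / 2 / p₁, by positivity,
    fun d' δs' hδs' hclose α' hα'0 hα' => ?_⟩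
  have hδ : q₀ / (2 * (S + 1)) * S ≤ q₀ / 2 := by
    have h1 : S / (S + 1) ≤ 1 := by rw [div_le_one (by linarith)]; linarith
    have h2 : q₀ / (2 * (S + 1)) * S = q₀ / 2 * (S / (S + 1)) := by field_simp
    rw [h2]
    exact (mul_le_mul_of_nonneg_left h1 (by linarith)).trans_eq (mul_one _)
  exact syncEquilibrium_expStable_lossy_rate_of_lyapunovCertificate i₀ hδs' hPs (half_pos hq₀)
    (fun u _ hne => hpos u hne)
    (fun u _ => (dotProduct_mulVec_le_sumAbs₁₅ P u).trans
      (mul_le_mul_of_nonneg_right (le_add_of_nonneg_right zero_le_one)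
        (Finset.sum_nonneg fun j _ => mul_self_nonneg (u j))))
    (fun u hu => lyapunovIneq_of_entries_close hq₀.le (hly u hu) hclose hδ) hα'0 hα'

/-! ### §3. SMALL TRANSFER CONDUCTANCES, explicitly, with the uniform rate -/

/-- ★★★ **CHIANG–CHU PERSISTENCE WITH A UNIFORM RATE.**  Under the hypotheses above there are `ε > 0`
and `ᾱ > 0` such that: for EVERY conductance matrix `G'` with `|G'_ij| ≤ ε`, every vector of
mechanical inputs `P'_m`, every equilibrium `δˢ'` of the LOSSY model `⟨H, D, P'_m, E, G', B, ω_s⟩` with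
`|δˢ'_i − δˢ_i| ≤ ε`, and EVERY `0 < α' < ᾱ`, the equilibrium is exponentially stable modulo the
rotation WITH RATE `α'` (`ρ, k` may depend on the lossy model; `ᾱ` does not).  The existence of such
a nearby equilibrium is not asserted.  MODEL: network-reduced classical swing model with transfer
conductances (constant-impedance loads folded in), `D_i > 0`, uniform `ω_s`.
[cite: Khalil2002, §9.1 Lemma 9.1 / Theorem 4.10, Theorem 4.6–4.7; SimpsonporcoDorflerBullo2013, §3 remark after Theorem 2 (arXiv:1206.5033 p0010 L22); DorflerBullo2012, §I (arXiv:0910.5673 p0008 L36–L40); Chiang1995, §6.1] -/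
theorem lossy_expStable_modRotation_rate_of_small_conductances (hM : ∀ i, 0 < d.M i)
    (hD : ∀ i, 0 < d.D i) (hB : ∀ i j, d.B i j = d.B j i) (hC : ∀ i j, 0 ≤ d.C i j)
    (hconn : ClassicalModel.CouplingConnected d.C) {δs : Fin m → ℝ}
    (harc : ∀ i j, i ≠ j → 0 < d.C i j → |δs i - δs j| < Real.pi / 2) (i₀ : Fin m) :
    ∃ ε > 0, ∃ αbar > 0, ∀ (Pm' : Fin m → ℝ) (G' : Fin m → Fin m → ℝ) (δs' : Fin m → ℝ),
      (∀ i j, |G' i j| ≤ ε) → (∀ i, |δs' i - δs i| ≤ ε) →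
      (⟨d.H, d.D, Pm', d.E, G', d.B, d.ωs⟩ : InternalNode m).IsEquilibrium δs' →
      ∀ α' : ℝ, 0 < α' → α' < αbar →
      ∃ ρ > 0, ∃ k > 0, ∀ δ ω : ℝ → Fin m → ℝ,
        (∀ t, (⟨d.H, d.D, Pm', d.E, G', d.B, d.ωs⟩ : InternalNode m).IsSolutionAt δ ω t) →
        ‖phase (δ 0 - δs') (fun i => ω 0 i - d.ωs)‖ < ρ →
        ∀ T : ℝ, 0 ≤ T → ∃ c : ℝ, ∀ t ∈ Icc 0 T,
          ‖phase (fun i => δ t i - (δs' i + c)) (fun i => ω t i - d.ωs)‖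
            ≤ k * ‖phase (δ 0 - δs') (fun i => ω 0 i - d.ωs)‖ * Real.exp (-α' * t) := by
  obtain ⟨δ₀, hδ₀, αbar, hαbar, hstab⟩ :=
    lossy_expStable_modRotation_rate_of_jacobian_close hM hD hB hC hconn harc i₀
  set W : ℝ := ∑ i, ∑ j, |d.E i * d.E j| * (2 * |d.B i j| + 1) with hW
  set Minv : ℝ := ∑ i, (d.M i)⁻¹ with hMinv
  have hW0 : 0 ≤ W := Finset.sum_nonneg fun i _ => Finset.sum_nonneg fun j _ =>
    mul_nonneg (abs_nonneg _) (by positivity)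
  have hMinv0 : 0 ≤ Minv := Finset.sum_nonneg fun i _ => (inv_pos.2 (hM i)).le
  refine ⟨δ₀ / (2 * W * Minv + 1), by positivity, αbar, hαbar,
    fun Pm' G' δs' hG hδ heq α' hα'0 hα' => ?_⟩
  have hclose : ∀ k l, |(⟨d.H, d.D, Pm', d.E, G', d.B, d.ωs⟩ : InternalNode m).swingJacG δs' k l
      - d.swingJac δs k l| ≤ δ₀ := fun k l => by
    refine (swingJacG_sub_swingJac_le (d := d) hM hG hδ k l).trans ?_
    have h1 : 2 * (δ₀ / (2 * W * Minv + 1)) * W * Minv = δ₀ * (2 * W * Minv / (2 * W * Minv + 1)) := by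
      field_simp
    have h2 : 2 * W * Minv / (2 * W * Minv + 1) ≤ 1 := by
      rw [div_le_one (by positivity)]; linarith [mul_nonneg (mul_nonneg zero_le_two hW0) hMinv0]
    rw [h1]
    exact (mul_le_mul_of_nonneg_left h2 hδ₀.le).trans_eq (mul_one _)
  exact hstab _ δs' heq hclose α' hα'0 hα'

end InternalNode

end Literature.MathematicalPhysics.PowerSystems

end
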